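import Mathlib
import Summits.Ventures.PercRepro2.Defs
import Summits.Ventures.PercRepro2.Harris
import Summits.Ventures.PercRepro2.Graph
import Summits.Ventures.PercRepro2.Induced
import Summits.Ventures.PercRepro2.VdBKahn
import Summits.Ventures.PercRepro2.NestIID

/-!
# Core-forbidding one vertex keeps two independent clusters' side signs positively correlated
(blind cell PercRepro2, mine-1 g10; MINE-1.md §26, proofs/MINE1-SAMEKERNEL-FRAME.md §6–§8)

Two independent Bernoulli(`p`) clusters `C, C'` of a root `s`, both avoiding `T`, and a vertex
`v ∉ T ∪ {x, y}`. The i.i.d. twin of the principal `(T, F)` family with `F = {v}` ("`v` is not a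
core vertex") is

`coreForbidIID T v = Σ_{ω,ω'} w(ω) w(ω') 1_{R_T}(ω) 1_{R_T}(ω') (1 − 1[v∈C] 1[v∈C']) σ_x σ_y ≥ 0`,

with `σ_x = 1[x∈C] − 1[x∈C']`. It is a THEOREM, from four instances of van den Berg–Kahn
(`vdBK`): writing `P_S = P(S ⊆ C, R_T)` (so `Q_S := P_S − P_{S∪v} = P(S ⊆ C, R_{T∪v})`),

`coreForbidIID T v = 2 [(P P_{xy} − P_x P_y) − (P_v P_{xyv} − P_{xv} P_{yv})]`
(`coreForbidIID_eq`), and the polynomial identity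

`P Q · [P P_{xy} − P_x P_y − P_v P_{xyv} + P_{xv} P_{yv}]
  = Q² (P P_{xy} − P_x P_y) + P P_v (Q Q_{xy} − Q_x Q_y) + (P P_{xv} − P_v P_x)(P P_{yv} − P_v P_y)`

exhibits the bracket as a nonnegative combination of the BHK slacks at `T` and at `T ∪ {v}` and of
the two "positive association of `x` (resp. `y`) with `v` given `R_T`" slacks
(`coreForbidIID_nonneg`). In conditional terms: `Cov(X,Y | R_T) ≥ P(v ∈ C | R_T)² · Cov(X,Y | R_T, v ∈ C)`
— the covariance GIVEN the connection `v ∈ C` (which may be negative) enters with the small factor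
`P(v ∈ C | R_T)²`. Contrast: the refuted (BHK-MONO)/(ΔMONO) (NEG-72) compared `Cov(X,Y | R_T)` with
`P(v ∉ C | R_T)² Cov(X,Y | R_{T∪v})`, i.e. forced `v` INTO the union; forbidding `v` from the CORE is
a down-type constraint and survives (census: union down-sets × `{v ∉ C ∩ C'}`, mild and extreme
palettes, `n = 6` all `m` 0 / 1,915,200; exact on the NEG-72 instance).
-/

namespace Summit.Ventures.PercRepro2

section CoreForbidIID

variable {V : Type*} {E : Type*} [Fintype E] [DecidableEq E] [Fintype V] [DecidableEq V]
  {R : Type*} [CommRing R] [LinearOrder R] [IsStrictOrderedRing R]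

/-- The two-copy sum with both clusters avoiding `T` and the vertex `v` forbidden from the core
`C ∩ C'`. -/
noncomputable def coreForbidIID (p : E → R) (ends : E → Sym2 V) (s x y : V) (T : Finset V)
    (v : V) : R :=
  ∑ ω : Config E, ∑ ω' : Config E,
    weight p ω * weight p ω' * avoidInd ends s T ω * avoidInd ends s T ω' *
      (1 - connInd ends s v ω * connInd ends s v ω') *
      ((connInd ends s x ω - connInd ends s x ω') * (connInd ends s y ω - connInd ends s y ω'))

variable (p : E → R) (ends : E → Sym2 V) (s : V)

omit [LinearOrder R] [IsStrictOrderedRing R] in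
/-- A one-copy sum with two distinct connection indicators. -/
lemma sum_weight_avoid_conn_two (T : Finset V) {a b : V} (hab : a ≠ b) :
    ∑ ω : Config E, weight p ω * avoidInd ends s T ω * (connInd ends s a ω * connInd ends s b ω) =
      prob p (connAll ends s ({a} ∪ {b}) ∩ avoidAll ends s T) := by
  rw [← sum_weight_avoid_conn p ends s T ({a} ∪ {b})]
  refine Finset.sum_congr rfl fun ω _ => ?_
  rw [Finset.prod_union (Finset.disjoint_singleton.2 hab), Finset.prod_singleton,
    Finset.prod_singleton]

omit [LinearOrder R] [IsStrictOrderedRing R] in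
/-- A one-copy sum with three distinct connection indicators. -/
lemma sum_weight_avoid_conn_three (T : Finset V) {a b c : V} (hab : a ≠ b) (hac : a ≠ c)
    (hbc : b ≠ c) :
    ∑ ω : Config E, weight p ω * avoidInd ends s T ω *
        (connInd ends s a ω * connInd ends s b ω * connInd ends s c ω) =
      prob p (connAll ends s ({a} ∪ {b} ∪ {c}) ∩ avoidAll ends s T) := by
  rw [← sum_weight_avoid_conn p ends s T ({a} ∪ {b} ∪ {c})]
  refine Finset.sum_congr rfl fun ω _ => ?_
  have hd : Disjoint ({a} ∪ {b} : Finset V) {c} := by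
    rw [Finset.disjoint_singleton_right, Finset.mem_union, Finset.mem_singleton,
      Finset.mem_singleton]
    rintro (h | h)
    · exact hac h.symm
    · exact hbc h.symm
  rw [Finset.prod_union hd, Finset.prod_union (Finset.disjoint_singleton.2 hab),
    Finset.prod_singleton, Finset.prod_singleton, Finset.prod_singleton]

omit [LinearOrder R] [IsStrictOrderedRing R] in
/-- The core-forbidden two-copy sum in one-copy probabilities. -/
theorem coreForbidIID_eq (x y : V) (T : Finset V) (v : V) (hxy : x ≠ y) (hxv : x ≠ v)
    (hyv : y ≠ v) :
    coreForbidIID p ends s x y T v =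
      prob p (avoidAll ends s T) * prob p (connAll ends s ({x} ∪ {y}) ∩ avoidAll ends s T) +
        prob p (connAll ends s ({x} ∪ {y}) ∩ avoidAll ends s T) * prob p (avoidAll ends s T) -
        prob p (connAll ends s {x} ∩ avoidAll ends s T) *
          prob p (connAll ends s {y} ∩ avoidAll ends s T) -
        prob p (connAll ends s {y} ∩ avoidAll ends s T) *
          prob p (connAll ends s {x} ∩ avoidAll ends s T) -
        (prob p (connAll ends s {v} ∩ avoidAll ends s T) *
            prob p (connAll ends s ({x} ∪ {y} ∪ {v}) ∩ avoidAll ends s T) +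
          prob p (connAll ends s ({x} ∪ {y} ∪ {v}) ∩ avoidAll ends s T) *
            prob p (connAll ends s {v} ∩ avoidAll ends s T) -
          prob p (connAll ends s ({x} ∪ {v}) ∩ avoidAll ends s T) *
            prob p (connAll ends s ({y} ∪ {v}) ∩ avoidAll ends s T) -
          prob p (connAll ends s ({y} ∪ {v}) ∩ avoidAll ends s T) *
            prob p (connAll ends s ({x} ∪ {v}) ∩ avoidAll ends s T)) := by
  classical
  have hx : prob p (connAll ends s {x} ∩ avoidAll ends s T) =
      ∑ ω : Config E, weight p ω * avoidInd ends s T ω * connInd ends s x ω := by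
    rw [← sum_weight_avoid_conn p ends s T {x}]; simp only [Finset.prod_singleton]
  have hy : prob p (connAll ends s {y} ∩ avoidAll ends s T) =
      ∑ ω : Config E, weight p ω * avoidInd ends s T ω * connInd ends s y ω := by
    rw [← sum_weight_avoid_conn p ends s T {y}]; simp only [Finset.prod_singleton]
  have hv : prob p (connAll ends s {v} ∩ avoidAll ends s T) =
      ∑ ω : Config E, weight p ω * avoidInd ends s T ω * connInd ends s v ω := by
    rw [← sum_weight_avoid_conn p ends s T {v}]; simp only [Finset.prod_singleton]
  have h0 : prob p (avoidAll ends s T) =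
      ∑ ω : Config E, weight p ω * avoidInd ends s T ω := by
    have := sum_weight_avoid_conn p ends s T ∅
    rw [connAll_empty, Set.univ_inter] at this
    rw [← this]; simp only [Finset.prod_empty, mul_one]
  have hxy' := sum_weight_avoid_conn_two p ends s T hxy
  have hxv' := sum_weight_avoid_conn_two p ends s T hxv
  have hyv' := sum_weight_avoid_conn_two p ends s T hyv
  have hxyv' := sum_weight_avoid_conn_three p ends s T hxy hxv hyv
  rw [hx, hy, hv, h0, ← hxy', ← hxv', ← hyv', ← hxyv']
  unfold coreForbidIID
  simp only [Finset.sum_mul_sum, ← Finset.sum_add_distrib, ← Finset.sum_sub_distrib]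
  refine Finset.sum_congr rfl fun ω _ => Finset.sum_congr rfl fun ω' _ => ?_
  ring

omit [Fintype V] [LinearOrder R] [IsStrictOrderedRing R] in
/-- Splitting an `R_T`-mass at the connection to `v`:
`P(A ⊆ C, R_{T ∪ v}) = P(A ⊆ C, R_T) − P(A ∪ {v} ⊆ C, R_T)`. -/
lemma prob_connAll_avoidAll_insert (A T : Finset V) (v : V) :
    prob p (connAll ends s A ∩ avoidAll ends s (insert v T)) =
      prob p (connAll ends s A ∩ avoidAll ends s T) -
        prob p (connAll ends s (A ∪ {v}) ∩ avoidAll ends s T) := by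
  have h := prob_inter_add_prob_inter_compl p (connAll ends s A ∩ avoidAll ends s T)
    {ω | Conn ends ω s v}
  have e1 : connAll ends s A ∩ avoidAll ends s T ∩ {ω | Conn ends ω s v} =
      connAll ends s (A ∪ {v}) ∩ avoidAll ends s T := by
    ext ω
    simp only [Set.mem_inter_iff, Set.mem_setOf_eq, connAll, avoidAll, Finset.mem_union,
      Finset.mem_singleton]
    constructor
    · rintro ⟨⟨hA, hT⟩, hv⟩
      exact ⟨fun a ha => ha.elim (hA a) (fun h => h ▸ hv), hT⟩
    · rintro ⟨hA, hT⟩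
      exact ⟨⟨fun a ha => hA a (Or.inl ha), hT⟩, hA v (Or.inr rfl)⟩
  have e2 : connAll ends s A ∩ avoidAll ends s T ∩ {ω | Conn ends ω s v}ᶜ =
      connAll ends s A ∩ avoidAll ends s (insert v T) := by
    ext ω
    simp only [Set.mem_inter_iff, Set.mem_compl_iff, Set.mem_setOf_eq, connAll, avoidAll,
      Finset.mem_insert, forall_eq_or_imp]
    tauto
  rw [e1, e2] at h
  linear_combination h

/-- **Core-forbidding one vertex keeps the side signs positively correlated** (i.i.d. twin of the
principal `(T, F)` family with `|F| = 1`): for `x ≠ y`, `v ∉ {x, y}` and any avoided set `T`,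
`coreForbidIID T v ≥ 0`, from four instances of van den Berg–Kahn. -/
theorem coreForbidIID_nonneg (hp : IsProbVec p) (x y : V) (T : Finset V) (v : V) (hxy : x ≠ y)
    (hxv : x ≠ v) (hyv : y ≠ v) : 0 ≤ coreForbidIID p ends s x y T v := by
  classical
  rw [coreForbidIID_eq p ends s x y T v hxy hxv hyv]
  set P0 := prob p (avoidAll ends s T) with hP0
  set Px := prob p (connAll ends s {x} ∩ avoidAll ends s T) with hPx
  set Py := prob p (connAll ends s {y} ∩ avoidAll ends s T) with hPy
  set Pv := prob p (connAll ends s {v} ∩ avoidAll ends s T) with hPv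
  set Pxy := prob p (connAll ends s ({x} ∪ {y}) ∩ avoidAll ends s T) with hPxy
  set Pxv := prob p (connAll ends s ({x} ∪ {v}) ∩ avoidAll ends s T) with hPxv
  set Pyv := prob p (connAll ends s ({y} ∪ {v}) ∩ avoidAll ends s T) with hPyv
  set Pxyv := prob p (connAll ends s ({x} ∪ {y} ∪ {v}) ∩ avoidAll ends s T) with hPxyv
  -- the masses at the larger avoided set `T ∪ {v}`
  set T' := insert v T with hT'
  have hQ0 : prob p (avoidAll ends s T') = P0 - Pv := by
    have := prob_connAll_avoidAll_insert p ends s ∅ T v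
    rw [connAll_empty, Set.univ_inter, Set.univ_inter, Finset.empty_union] at this
    exact this
  have hQx : prob p (connAll ends s {x} ∩ avoidAll ends s T') = Px - Pxv :=
    prob_connAll_avoidAll_insert p ends s {x} T v
  have hQy : prob p (connAll ends s {y} ∩ avoidAll ends s T') = Py - Pyv :=
    prob_connAll_avoidAll_insert p ends s {y} T v
  have hQxy : prob p (connAll ends s ({x} ∪ {y}) ∩ avoidAll ends s T') = Pxy - Pxyv :=
    prob_connAll_avoidAll_insert p ends s ({x} ∪ {y}) T v
  -- the four van den Berg–Kahn instances
  have h1 : Px * Py ≤ Pxy * P0 := by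
    have h := vdBK p hp ends s {x} {y} T T
    simpa only [Finset.inter_self, Finset.union_self] using h
  have h2 : (Px - Pxv) * (Py - Pyv) ≤ (Pxy - Pxyv) * (P0 - Pv) := by
    have h := vdBK p hp ends s {x} {y} T' T'
    simp only [Finset.inter_self, Finset.union_self] at h
    rwa [hQx, hQy, hQxy, hQ0] at h
  have h3 : Px * Pv ≤ Pxv * P0 := by
    have h := vdBK p hp ends s {x} {v} T T
    simpa only [Finset.inter_self, Finset.union_self] using h
  have h4 : Py * Pv ≤ Pyv * P0 := by
    have h := vdBK p hp ends s {y} {v} T T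
    simpa only [Finset.inter_self, Finset.union_self] using h
  -- nonnegativity and domination
  have hP0n : 0 ≤ P0 := prob_nonneg hp _
  have hPvn : 0 ≤ Pv := prob_nonneg hp _
  have hQ0n : 0 ≤ P0 - Pv := by rw [← hQ0]; exact prob_nonneg hp _
  have hQxn : 0 ≤ Px - Pxv := by rw [← hQx]; exact prob_nonneg hp _
  have hQyn : 0 ≤ Py - Pyv := by rw [← hQy]; exact prob_nonneg hp _
  have hQxyn : 0 ≤ Pxy - Pxyv := by rw [← hQxy]; exact prob_nonneg hp _
  have hPx0 : Px ≤ P0 := prob_mono hp Set.inter_subset_right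
  have hPy0 : Py ≤ P0 := prob_mono hp Set.inter_subset_right
  have hPxy0 : Pxy ≤ P0 := prob_mono hp Set.inter_subset_right
  have hPxv0 : Pxv ≤ P0 := prob_mono hp Set.inter_subset_right
  have hPyv0 : Pyv ≤ P0 := prob_mono hp Set.inter_subset_right
  have hPxyv0 : Pxyv ≤ P0 := prob_mono hp Set.inter_subset_right
  have hPxn : 0 ≤ Px := prob_nonneg hp _
  have hPyn : 0 ≤ Py := prob_nonneg hp _
  have hPxyn : 0 ≤ Pxy := prob_nonneg hp _
  have hPxvn : 0 ≤ Pxv := prob_nonneg hp _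
  have hPyvn : 0 ≤ Pyv := prob_nonneg hp _
  have hPxyvn : 0 ≤ Pxyv := prob_nonneg hp _
  have hQx0 : Px - Pxv ≤ P0 - Pv := by
    rw [← hQx, ← hQ0]; exact prob_mono hp Set.inter_subset_right
  have hQy0 : Py - Pyv ≤ P0 - Pv := by
    rw [← hQy, ← hQ0]; exact prob_mono hp Set.inter_subset_right
  have hQxy0 : Pxy - Pxyv ≤ P0 - Pv := by
    rw [← hQxy, ← hQ0]; exact prob_mono hp Set.inter_subset_right
  -- the target bracket
  set L := P0 * Pxy - Px * Py - Pv * Pxyv + Pxv * Pyv with hL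
  suffices hLn : 0 ≤ L by
    have : P0 * Pxy + Pxy * P0 - Px * Py - Py * Px -
        (Pv * Pxyv + Pxyv * Pv - Pxv * Pyv - Pyv * Pxv) = 2 * L := by rw [hL]; ring
    linarith
  -- the key identity: `P0 (P0 − Pv) L` is a sum of three nonnegative terms
  have key : P0 * (P0 - Pv) * L =
      (P0 - Pv) ^ 2 * (P0 * Pxy - Px * Py) +
        P0 * Pv * ((P0 - Pv) * (Pxy - Pxyv) - (Px - Pxv) * (Py - Pyv)) +
        (P0 * Pxv - Pv * Px) * (P0 * Pyv - Pv * Py) := by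
    rw [hL]; ring
  have hS1 : 0 ≤ P0 * Pxy - Px * Py := by linarith
  have hS2 : 0 ≤ (P0 - Pv) * (Pxy - Pxyv) - (Px - Pxv) * (Py - Pyv) := by linarith
  have hS3 : 0 ≤ P0 * Pxv - Pv * Px := by linarith
  have hS4 : 0 ≤ P0 * Pyv - Pv * Py := by linarith
  have hprod : 0 ≤ P0 * (P0 - Pv) * L := by
    rw [key]
    exact add_nonneg (add_nonneg (mul_nonneg (pow_nonneg hQ0n 2) hS1)
      (mul_nonneg (mul_nonneg hP0n hPvn) hS2)) (mul_nonneg hS3 hS4)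
  rcases hP0n.lt_or_eq with hP0pos | hP0zero
  · rcases hQ0n.lt_or_eq with hQ0pos | hQ0zero
    · -- main case
      have hPQ : 0 < P0 * (P0 - Pv) := mul_pos hP0pos hQ0pos
      by_contra hneg
      have hneg' : L < 0 := not_le.1 hneg
      have := mul_neg_of_pos_of_neg hPQ hneg'
      linarith
    · -- `P(R_{T∪v}) = 0`: every `Q`-mass vanishes and `L = 0`
      have hPvP : Pv = P0 := by linarith
      have e1 : Pxv = Px := by linarith
      have e2 : Pyv = Py := by linarith
      have e3 : Pxyv = Pxy := by linarith
      rw [hL, hPvP, e1, e2, e3]; ring_nf; exact le_refl _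
  · -- `P(R_T) = 0`: every mass vanishes
    have e0 : P0 = 0 := hP0zero.symm
    have ex : Px = 0 := le_antisymm (e0 ▸ hPx0) hPxn
    have ey : Py = 0 := le_antisymm (e0 ▸ hPy0) hPyn
    have ev : Pv = 0 := le_antisymm (by rw [← e0]; exact prob_mono hp Set.inter_subset_right) hPvn
    have exy : Pxy = 0 := le_antisymm (e0 ▸ hPxy0) hPxyn
    have exv : Pxv = 0 := le_antisymm (e0 ▸ hPxv0) hPxvn
    have eyv : Pyv = 0 := le_antisymm (e0 ▸ hPyv0) hPyvn
    have exyv : Pxyv = 0 := le_antisymm (e0 ▸ hPxyv0) hPxyvn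
    rw [hL, e0, ex, ey, ev, exy, exv, eyv, exyv]; norm_num

end CoreForbidIID

end Summit.Ventures.PercRepro2
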